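import Summits.QuantumFields.YangMills.Theorems.ForcedResponseSkewnessResponseLocalisationDefs
import HarnessLib

/-!
# Route `ForcedResponseSkewness`, crux `ResponseLocalisation` (stmt-QuantumFields-24869): vocabulary of line «smeared-femto»

Route-posited statements (D-0016 `<Route><Crux>Defs`-class file, second volume: the first,
`ForcedResponseSkewnessResponseLocalisationDefs.lean`, is at the 400-line cap) of the lead `ym-line-frs-p1` g4's line
«smeared-femto» on the UNCHANGED rev-5 deciding crux.  Same namespace `Summit.QuantumFields.YangMills.Cruxes.ResponseLocalisation.Birth`.
NOTHING here is asserted: every `def … : Prop` is a line statement some registered stub proves (none is a literature fact, none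
restates the crux).  No summit is proved by any of this (leaf R2a `BalabanLadder.NT`, conditional rung line; the YM mass gap is NOT proved).
-/

set_option autoImplicit false

noncomputable section

namespace Summit.QuantumFields.YangMills.Cruxes.ResponseLocalisation.Birth

open MeasureTheory Filter Topology
open Literature.MathematicalPhysics.QuantumFieldTheory Literature.MathematicalPhysics.QuantumLattice
open Literature.Probability.LatticeModels
open Summit.QuantumFields.YangMills.Cruxes.OSLegsFromFemtoAndGap.DlrCollarTransfer

/-! ## Route rev 5, line «smeared-femto» (lead ym-line-frs-p1 g4, 2026-08-28): the collar share IS femto-isable once the NEAR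
partner is smeared against the source — REFINEMENT of the g3 lesson, on the UNCHANGED crux (stmt-QuantumFields-24869)

The g3 obstruction is a statement about the near pair `(x, z)` with BOTH sites sharp: the linear-background term
`(g₀²/N²) B_{μν} B_{ρν} ∂_μ∂_ρ G(z − x)` is `≍ g₀²Φ²/(D⁴|z−x|⁴)`, sign-indefinite (d-wave), and its absolute sum over a ball is
`g₀² log(R/a) · Φ²/D⁴ = O(Φ²)/D⁴` in a pinned unit.  But the crux never sees the sharp pair: its collar term is
`|respM(x)| = |Σ_{y,z} θv(s y) v(s z) κ₃(x,y,z)|` with the near partner `z` ALREADY smeared against the fixed Schwartz source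
`v(s·)`, `s = l·a(β)`.  For the smeared pair the same term is `Σ_z v(s z) ∂_μ∂_ρG(z − x) = Σ_z (∂_μ∂_ρ v_s)(z) G(z − x)`
(summation by parts; `G ≍ |w|⁻²` is summable in `d = 4`), of size `≤ C ρ² ‖∂²v‖_∞` per collar site — NO logarithm — so its collar
sum is `#collar · (a/c)⁴ · O_v(1) · g₀²(β) Φ² = O_v(1) · g₀²(β) → 0`: killed by a `v`-DEPENDENT coupling threshold, which the crux
allows (`β₆` is chosen after `v`).  What is left of the exterior-dependence of the smeared near-pair covariance is (i) lattice-contact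
and image terms, all `∝ g₀²(β) · (norms of v) → 0`, and (ii) the isotropic RUNNING remainder `|B|² · 2b₀ ḡ⁴(a|z−x|)/|z−x|⁴`, positive and
summable: an `L¹`-type majorant `Σ_z |v(s z)| μ_β(z − x)` with `Σ_{a|w|<R} μ_β(w) ≍ ḡ²(R) − g₀² ≤ κ` for a small cut `R` — controlled
by `∫|v| ≤ 1` alone.  Hence the

* `NearPairLawS G r a` — SMEARED NEAR-PAIR LAW (femto, all exteriors): `∃ ℓ₂ ∀ κ ∃ R β₂ n μ` (`μ ≥ 0`, `Σ_{a|w|≤R} μ_β ≤ κ`) such that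
  for every Schwartz `v` and window `Λ` SOME threshold `β₃` gives, for `β ≥ max β₂ β₃`, every femto cube `(c,b)` (`b·a(β) ≤ ℓ₂`),
  every exterior `η`, every site `x` and `l ∈ [1,Λ]`, and every finite `B ⊇ {z : v((l·a β)·z) ≠ 0}` sitting in the inner half around
  `x` (`a β‖z−x‖ ≤ R`, `2‖z−x‖ + 2 ≤ depth x` on `B`):
  `|Σ_{z∈B} v((l a β)·z) · (kerCov_η(dens x, dens z) − n_β(z−x))| ≤ (κ + Σ_{z∈B} |v((l a β)·z)| μ_β(z−x)) / depth(x)⁴`.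
  One-loop check (RG-improved, flux background `B ≍ Φ/D²`): smooth d-wave part `g₀²Φ²ρ²‖∂²v‖/D⁴`, contact `g₀²Φ²|v(s x)|/D⁴`,
  images `g₀²Φ²(R/aD)⁴‖v‖_∞/D⁴`, `∇B`-terms `g₀²Φ²ρ‖v‖_∞ a/D⁵·(1/a)`, two-loop image `g₀⁴ log · ‖v‖_∞/D⁴ ≍ g₀²‖v‖_∞/D⁴` — all `→ 0` with
  `β` at fixed `v` (the `κ` slot, threshold `β₃(v)`); running remainder `≤ Σ_z |v| μ(z−x)/D⁴` (the majorant slot).  TRUE at that level;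
  the abelian/Gaussian analogue is FALSE (no `g₀ → 0`, no running — the lever is `b₀ > 0`, as for `ContactKernelSigR`, p600100).  As a
  theorem: Bałaban small-field RG in a femto cube with arbitrary exterior, composite-operator covariance response — not in print.
* `NearPairLawSSigR` — the same along a unit pinned by a compactly supported positive-time clause-(i) floor witness (the registered
  AF stub `stub_nearPairS` of line «smeared-femto»).
* `SmearedKernelSigR` — TORUS LEVEL, per far site: for a pinned unit, every `r₁ > 0` and `κ > 0` some `R > 0` such that for every
  Schwartz weight `w` and window `Λ ≥ 1`, for all large `β`, tori `a(β)·L ≥ Λ₀`, `l ∈ [1,Λ]`, every far site `y` and centre `z₁ ∈ box L`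
  (`‖a(β) z₁‖ ≤ Λ`, `r₁ ≤ a(β)·d_T(y,z₁)`, the lattice support of `w((l a β)·)` inside `box L` and within `a(β)`-distance `R` of `z₁`,
  Riemann mass `a(β)⁴ Σ_z |w((l a β) z)| ≤ 2`):  `Σ_{x : a(β) d_T(x,z₁) < R} |Σ_z w((l a β) z) κ₃^T(x,y,z)| ≤ κ · a(β)⁴`
  (hyperscaling: `a⁴` for the sharp far insertion; the smeared near pair is `O(1)`-normalised by the Riemann mass).
* `SmearedKernelOfFemtoSigR := FBLPinnedSigR → NearPairLawSSigR → SmearedKernelSigR` (ANALYSIS, registered stub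
  `stub_smearedKernelOfFemto`, lead): the collar transfer of `contactKernel_of_femto` with the near observable
  `A₂ = (dens x − m_x) · Σ_z w(s z)(dens z − m_z)` carried by ONE femto cube around `z₁` lying inside the box (no wrap-around), the far
  observable `dens y` in its own cube; `|Σ_z w κ₃| ≤ 4 ε₁ ε₂(x)` with `ε₁ = C₁'/M⁴`, `ε₂(x) = (κ' + Σ_z|w|μ)/(M/2)⁴ + S_w (32C₁/M⁴)²`.
* `CollarOfSmearedSigR := SmearedKernelSigR →` crux body (ANALYSIS, registered stub `stub_collarOfSmeared`, width seat frs-p2): the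
  geometry of `stub_collarOfKernel` (p600411) with the triangle inequality over the FAR index only:
  `1_collar(x) |Σ_{y,z} θv v κ₃(x,y,z)| ≤ 1_{x near v-ball} Σ_y |θv(s y)| |Σ_z v(s z) κ₃(x,y,z)| + 1_{x near θv-ball} Σ_z |v(s z)| |Σ_y θv(s y) κ₃(x,z,y)|`
  (`torusK3_swap`), the kernel statement applied to the weights `v` and `thetaTest 4 v`, Riemann sums `s⁴Σ|v(s·)|, s⁴Σ|θv(s·)| ≤ 2`.
Composition: `ResponseLocalisation_holds := stub_collarOfSmeared (stub_smearedKernelOfFemto (fblPinnedSigR_of_fbl6 stub_fbl6Pinned) stub_nearPairS)`.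
Nothing here is asserted.  No summit is proved by any of this (leaf R2a `BalabanLadder.NT`, conditional rung line; the YM mass gap is NOT proved). -/

section SmearedFemto

variable (G : Type) [Group G] [TopologicalSpace G] [IsTopologicalGroup G] [CompactSpace G]
  [MeasurableSpace G] [BorelSpace G] (r : LatticeRep G) (a : ℝ → ℝ)

/-- **Smeared near-pair conditional-covariance law** (femto, all exteriors; the AF clause of line «smeared-femto»): there is a
femto scale `ℓ₂ > 0` such that for every `κ > 0` some physical cut `R > 0`, threshold `β₂`, reference values `n_β(w)` and a
non-negative majorant `μ_β(w)` with `Σ_{w ∈ B} μ_β(w) ≤ κ` for every finite `B` inside the closed physical `R`-ball satisfy: for every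
real Schwartz `v` and window `Λ` there is a threshold `β₃` such that for `β ≥ max β₂ β₃`, every cube `(c,b)` with `b·a(β) ≤ ℓ₂`, every
exterior `η`, every site `x`, every `l ∈ [1,Λ]` and every finite `B` containing the lattice support of `z ↦ v((l·a β)·z)` and lying
in the inner half around `x` (`a β‖z−x‖ ≤ R`, `2‖z−x‖ + 2 ≤ depth x`), the `v`-smeared deviation
`|Σ_{z∈B} v((l a β)·z)(kerCov_η(dens x, dens z) − n_β(z−x))|` is at most `(κ + Σ_{z∈B} |v((l a β)·z)| μ_β(z−x)) / depth(c,b,x)⁴`.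
(Physics: the `κ` slot carries the lattice-contact / smoothed d-wave / image terms, all `∝ g₀²(β)·‖v‖ → 0`; the majorant slot carries the
isotropic running remainder `μ_β(w) ≍ 2b₀ḡ⁴(|w|a(β))/|w|⁴·Φ²_max`, `Σ_{|w|<R/a} μ ≍ ḡ²(R) → 0` with the cut.  See the section docstring.) -/
def NearPairLawS : Prop :=
  ∃ ℓ₂ : ℝ, 0 < ℓ₂ ∧ ∀ κ : ℝ, 0 < κ → ∃ R : ℝ, 0 < R ∧ ∃ (β₂ : ℝ) (n μ : ℝ → (Fin 4 → ℤ) → ℝ),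
    (∀ β w, 0 ≤ μ β w) ∧
    (∀ (β : ℝ) (B : Finset (Fin 4 → ℤ)), β₂ ≤ β → (∀ w ∈ B, a β * ‖siteToE w‖ ≤ R) → ∑ w ∈ B, μ β w ≤ κ) ∧
    ∀ (v : SchwartzMap (EuclideanSpace ℝ (Fin 4)) ℝ) (Λ : ℝ), ∃ β₃ : ℝ, ∀ β : ℝ, β₂ ≤ β → β₃ ≤ β →
      ∀ (c : Fin 4 → ℤ) (b : ℕ), (b : ℝ) * a β ≤ ℓ₂ →
        ∀ (η : LGConfig 4 G) (x : Fin 4 → ℤ) (l : ℝ), l ∈ Set.Icc 1 Λ →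
          ∀ B : Finset (Fin 4 → ℤ), (∀ z : Fin 4 → ℤ, v ((l * a β) • siteToE z) ≠ 0 → z ∈ B) →
            (∀ z ∈ B, a β * ‖siteToE (z - x)‖ ≤ R ∧ 2 * ‖siteToE (z - x)‖ + 2 ≤ (depth c b x : ℝ)) →
            |∑ z ∈ B, v ((l * a β) • siteToE z) * (kerCov G r β c b η (dens G r x) (dens G r z) - n β (z - x))| ≤
              (κ + ∑ z ∈ B, |v ((l * a β) • siteToE z)| * μ β (z - x)) / (depth c b x : ℝ) ^ 4

end SmearedFemto

/-- **Statement of `stub_nearPairS` of line «smeared-femto»** (ASYMPTOTIC-FREEDOM class, femto currency, the line's debt): the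
smeared near-pair conditional-covariance law `NearPairLawS G r a` along a unit pinned by a compactly supported positive-time
clause-(i) floor witness. -/
def NearPairLawSSigR : Prop :=
  ∀ (G : Type) [Group G] [TopologicalSpace G] [IsTopologicalGroup G] [CompactSpace G],
    IsCompactSimpleLieGroup G →
    letI : MeasurableSpace G := borel G
    haveI : BorelSpace G := ⟨rfl⟩
    ∀ (r : LatticeRep G) (a : ℝ → ℝ), (∀ β, 0 < a β) → Filter.Tendsto a Filter.atTop (nhds 0) →
      (∃ (v₀ : SchwartzMap (EuclideanSpace ℝ (Fin 4)) ℝ) (ε β₅ Λ₅ : ℝ), HasCompactSupport v₀ ∧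
        tsupport v₀ ⊆ {y : EuclideanSpace ℝ (Fin 4) | 0 < y 0} ∧ 0 < ε ∧
        ∀ β : ℝ, β₅ ≤ β → ∀ L : ℕ, Λ₅ ≤ a β * L → ε ≤ Q2 G r β L (a β) (thetaTest 4 v₀) v₀) →
      NearPairLawS G r a

/-- **Statement of the torus-level smeared collar kernel** (conclusion of `stub_smearedKernelOfFemto`, hypothesis of
`stub_collarOfSmeared`): along a pinned unit, for every separation `r₁ > 0` and `κ > 0` some `R > 0` such that for every real
Schwartz weight `w` and window `Λ ≥ 1`, for all large `β`, tori `a(β)·L ≥ Λ₀`, `l ∈ [1,Λ]`, every far site `y ∈ box L` and centre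
`z₁ ∈ box L` with `‖a(β)·z₁‖ ≤ Λ`, `r₁ ≤ a(β)·d_T(y,z₁)`, the lattice support of `w((l·a β)·)` inside `box L` and within `a(β)`-distance
`R` of `z₁`, and Riemann mass `a(β)⁴ Σ_z |w((l a β)·z)| ≤ 2`:
`Σ_{x ∈ box L : a(β)·d_T(x,z₁) < R} |Σ_{z ∈ box L} w((l a β)·z) · torusK3 β L x y z| ≤ κ · a(β)⁴`. -/
def SmearedKernelSigR : Prop :=
  ∀ (G : Type) [Group G] [TopologicalSpace G] [IsTopologicalGroup G] [CompactSpace G],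
    IsCompactSimpleLieGroup G →
    letI : MeasurableSpace G := borel G
    haveI : BorelSpace G := ⟨rfl⟩
    ∀ (r : LatticeRep G) (a : ℝ → ℝ), (∀ β, 0 < a β) → Filter.Tendsto a Filter.atTop (nhds 0) →
      (∃ (v₀ : SchwartzMap (EuclideanSpace ℝ (Fin 4)) ℝ) (ε β₅ Λ₅ : ℝ), HasCompactSupport v₀ ∧
        tsupport v₀ ⊆ {y : EuclideanSpace ℝ (Fin 4) | 0 < y 0} ∧ 0 < ε ∧
        ∀ β : ℝ, β₅ ≤ β → ∀ L : ℕ, Λ₅ ≤ a β * L → ε ≤ Q2 G r β L (a β) (thetaTest 4 v₀) v₀) →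
      ∀ r₁ : ℝ, 0 < r₁ → ∀ κ : ℝ, 0 < κ → ∃ R : ℝ, 0 < R ∧
        ∀ (w : SchwartzMap (EuclideanSpace ℝ (Fin 4)) ℝ) (Λ : ℝ), 1 ≤ Λ → ∃ β₀ Λ₀ : ℝ, ∀ β : ℝ, β₀ ≤ β →
          ∀ L : ℕ, Λ₀ ≤ a β * L → ∀ l : ℝ, l ∈ Set.Icc 1 Λ →
            ∀ y ∈ box 4 L, ∀ z₁ ∈ box 4 L, ‖(a β) • siteToE z₁‖ ≤ Λ →
              r₁ ≤ a β * Summit.QuantumFields.YangMills.Cruxes.RunningCouplingCeiling.Pointwise.torusDist L y z₁ →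
              (∀ z : Fin 4 → ℤ, w ((l * a β) • siteToE z) ≠ 0 → z ∈ box 4 L ∧ a β * ‖siteToE (z - z₁)‖ ≤ R) →
              (a β) ^ 4 * ∑ z ∈ box 4 L, |w ((l * a β) • siteToE z)| ≤ 2 →
                (∑ x ∈ box 4 L,
                  (if a β * Summit.QuantumFields.YangMills.Cruxes.RunningCouplingCeiling.Pointwise.torusDist L x z₁ < R then
                    |∑ z ∈ box 4 L, w ((l * a β) • siteToE z) * torusK3 G r β L x y z| else 0)) ≤ κ * (a β) ^ 4

/-- **Statement of `stub_smearedKernelOfFemto` of line «smeared-femto»** (ANALYSIS, provable now; lead): the two femto laws along the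
pinned unit imply the torus-level smeared collar kernel — the collar transfer of `contactKernel_of_femto` with the smeared near
observable `(dens x − m_x)·Σ_z w(s z)(dens z − m_z)`. -/
def SmearedKernelOfFemtoSigR : Prop :=
  FBLPinnedSigR → NearPairLawSSigR → SmearedKernelSigR

/-- **Statement of `stub_collarOfSmeared` of line «smeared-femto»** (ANALYSIS, provable now; width seat frs-p2): the torus-level
smeared collar kernel implies the rev-4/5 crux `ResponseLocalisation` (its body verbatim: the collar bound with `0 < p 0`). -/
def CollarOfSmearedSigR : Prop :=
  SmearedKernelSigR →
  ∀ (G : Type) [Group G] [TopologicalSpace G] [IsTopologicalGroup G] [CompactSpace G], IsCompactSimpleLieGroup G → letI : MeasurableSpace G := borel G; haveI : BorelSpace G := ⟨rfl⟩; ∀ (r : LatticeRep G) (a : ℝ → ℝ), (∀ β, 0 < a β) → Filter.Tendsto a Filter.atTop (nhds 0) → ∀ (p : EuclideanSpace ℝ (Fin 4)), 0 < p 0 → ∀ (ε : ℝ), 0 < ε → ∀ η : ℝ, 0 < η → ∀ Λ : ℝ, 1 ≤ Λ → ∃ ρ : ℝ, 0 < ρ ∧ ∀ v : SchwartzMap (EuclideanSpace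 ℝ (Fin 4)) ℝ, tsupport v ⊆ Metric.closedBall p ρ → tsupport v ⊆ {y : EuclideanSpace ℝ (Fin 4) | 0 < y 0} → (∫ y, |v y|) ≤ 1 → (∃ β₅ Λ₅ : ℝ, ∀ β : ℝ, β₅ ≤ β → ∀ L : ℕ, Λ₅ ≤ a β * L → ε ≤ Q2 G r β L (a β) (thetaTest 4 v) v) → ∃ δ : ℝ, 0 < δ ∧ ∃ β₆ Λ₆ : ℝ, ∀ β : ℝ, β₆ ≤ β → ∀ L : ℕ, Λ₆ ≤ a β * L → ∀ l : ℝ, l ∈ Set.Icc 1 Λ → (∑ x ∈ box 4 L, (if Metric.infDist ((l * a β) • siteToE x) (tsupport v ∪ tsupport (thetaTest 4 v)) < δ then |∑ y ∈ box 4 L, ∑ z ∈ box 4 L, (thetaTest 4 v) ((l * a β) • siteToE y) * v ((l * a β) • siteToE z) * torusK3 G r β L x y z| else 0)) ≤ η * (1 + |deriv (fun c : ℝ => Q2 G r c L (l * a β) (thetaTest 4 v) v) β|)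


/-! ## CORRECTION (lead ym-line-frs-p1 g4, 2026-08-28T08:00Z): `NearPairLawS` is believed FALSE as typed — line «smeared-femto» is dead

Width seats frs-p2 (06:41Z) and frs-p3 (06:43Z arbitration, 07:12Z model check with a counter-family, evidence on 24869) are right:
the coefficient of the flux-background cross term at lattice separation `|w| ≫ 1` is the RUNNING `ḡ²(|w|·a(β))` (the flux ANGLE is
RG-invariant and `dens/a⁴` is RGI at leading order, so the `O(B²)` response of the near-pair covariance is an RGI function of
`ḡ(|w|a)`), not the bare `g₀²(β)`.  For a fixed smooth `v` the summation-by-parts gain of the section above only converts the per-site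
logarithm into the β-INDEPENDENT number `Φ²·p.v.∫ ṽ(u) ḡ²(|u|) Y₂(û)|u|⁻⁴ d⁴u ≠ 0` (for `x` off the symmetry centre of `v`), which the
threshold `β₃(v)` cannot move into the `κ` slot; the law is degree one in `v` against an absolute `κ`, so scaling `v` kills it, and
for rough admissible `v` (mollified sign pattern of `Y₂`) the Calderón–Zygmund logarithm returns.  Root cause: the method's kernel
(`sup_η`-oscillation `∋ Φ²ḡ²Y₂/|w|⁴`) is not `ℓ¹`; only a SYMMETRIC signed `x`-sum (this section) or the `η`-average (torus level,
ring cancellation) removes the d-wave term.  `NearPairLawS` / `NearPairLawSSigR` stay as definitions only (never to be staffed); the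
landed implications (`stub_collarOfSmeared` p611645, toolkit p611321, per-site p611863) are correct theorems with a model-false
antecedent.  Record: `Cruxes/ResponseLocalisation/Lines/smeared-femto-dead.md`.

## Line «signed-femto-collar» (design: width seat frs-p2 g6, evidence #23 `SignedDesign-frs-p2.lean`; adopted and amended by the
lead g4): the crux RESTATED to the SIGNED smooth-collar share (route rev 6), femto-ised by a hypercubically symmetric smeared law

The restated crux `ResponseLocalisation` (owner edit requested 2026-08-28T08:0xZ) keeps the rev-5 prefix and replaces the conclusion
by: SOME `δ > 0` and SOME real Schwartz cut-off `χ` with values in `[0,1]`, equal to `1` on the `δ`-thickening of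
`tsupport v ∪ tsupport θv` and vanishing outside a ball, such that the SIGNED `χ`-weighted response share
`|Σ_x χ((l a β) x) · respM(x)|` is `≤ η(1 + |∂_cQ2|)` — a pure WEAKENING of rev 5 (p2's `signed_of_current`: Urysohn bump) and ALL
the Assembly uses (p2's `assembly_of_signed` with the signed glue `relLocalisation_of_signedCollar_far`, p612014).  The line:

* `SymNearCovLaw G r a` — femto, all exteriors, SIGNED and RADIALLY SMEARED about the sharp site `z`: `∃ ℓ₂ ∀ κ ∀ d₀ ∈ (0,ℓ₂] ∃ R ≤ d₀
  ∃ β₂ n ∀ β ≥ β₂ ∀ femto cube ∀ η ∀ z` (ball of physical radius `R` around `z` inside the cube with margin, PHYSICAL depth `≥ d₀`)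
  `∀ finite B ⊇ ball ∀ radial profile |φ| ≤ 1 supported in [0,R)`:  `|Σ_{w∈B} φ(a β‖w‖)(kerCov_η(dens(z+w), dens z) − n_β(w))| ≤ κ/depth(z)⁴`.
  Model check (RG one loop, flux background `B ≍ Φ/depth²`, running coefficients): the d-wave cross term `Φ²ḡ²(|w|a)Y₂(ŵ)/|w|⁴`
  cancels on every lattice sphere (hyperoctahedral trace identity, tree lemmas `LatticeCalculus.finsum_mul_secondDiff_eq_quarter_laplacian`,
  `finsum_mul_mixedCentralDiff_eq_zero`, p610949); the isotropic remainder `2b₀ḡ⁴/|w|⁴` sums to `≍ ḡ²(R) → 0`; `∇B` terms are odd;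
  `∇²B` terms cost `Φ²ḡ²(R)(R/d₀)²`; the boundary-image d-wave term costs `Φ²ḡ²(2d₀)(R/d₀)⁴` — AMENDMENT (lead): this is why the
  physical depth `d₀` is fixed BEFORE `R` (p2's draft tied depth to `2R/aβ + 2`, which leaves the image term a fixed fraction of
  `Φ²ḡ²/depth⁴`); lattice-contact and plaquette-asymmetry terms `≍ g₀²(β)φ(0)` need `β₂`.  TRUE at that level; abelian analogue false
  (no running).  Engine: Bałaban small-field RG in a femto cube with arbitrary exterior — composite-operator covariance response; not in print.
* `SymNearCovLawSigR` — the same along a pinned unit (registered AF stub `stub_symNearCovLaw`).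
* `SymContactKernelSigR` (p2's text verbatim) — TORUS level, signed radial near-ball sums: pinned unit, pairs at physical torus separation in
  `[r₁,r₂]`, ball inside the box: `|Σ_x φ(a β‖x−z‖) κ₃^T(x,y,z)| ≤ κ·a(β)⁸` for every radial `|φ| ≤ 1` supported in `[0,R(κ))`.
  Weaker than `ContactKernelSigR` (absolute ball mass).
* `SymContactOfFemtoSigR := FBLPinnedSigR → SymNearCovLawSigR → SymContactKernelSigR` (ANALYSIS, registered stub `stub_symContactOfFemto`,
  frs-p2 — `contactKernel_of_femto` with the radial weight inside the near observable `A₂ := Σ_w φ (dens(z+w) − m)(dens z − m)`; done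
  against local texts 06:41Z, to be re-pointed here with `d₀ := s/4`).
* `SignedOfSymKernelSigR := SymContactKernelSigR → FBLPinnedSigR →` restated crux body (ANALYSIS, registered stub `stub_signedOfSymKernel`,
  frs-p2): charged-pair geometry of `stub_collarOfKernel`; `χ := ψ(|·−p|) + ψ(|·−θp|)` radial bumps in `[0,1]`; the `z`-centred
  symmetric part `ψ(l·a β|x−z|)` is a radial profile for the kernel statement; the offset `ψ(|s x − p|) − ψ(s|x − z|)` lives on ONE
  physical shell with sup `≤ ρ/δ` and is paid by `MomentBounds` (`n = 3`, tree `DlrCollarTransfer.stub_collar ∘ fbl_of_fbl6`) × `ρ/δ`,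
  `ρ` being chosen after `R(κ)` and `δ`.
Composition: `ResponseLocalisation_holds := stub_signedOfSymKernel (stub_symContactOfFemto (fblPinnedSigR_of_fbl6 stub_fbl6Pinned)
stub_symNearCovLaw) (fblPinnedSigR_of_fbl6 stub_fbl6Pinned)`.  Nothing here is asserted.  No summit is proved by any of this. -/

section SignedFemto

variable (G : Type) [Group G] [TopologicalSpace G] [IsTopologicalGroup G] [CompactSpace G]
  [MeasurableSpace G] [BorelSpace G] (r : LatticeRep G) (a : ℝ → ℝ)

/-- **Signed, radially smeared near-pair conditional-covariance law** (femto, all exteriors; the AF clause of line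
«signed-femto-collar»; design frs-p2, depth decoupling by the lead): a femto scale `ℓ₂ > 0` such that for every `κ > 0` and every
physical depth `d₀ ∈ (0, ℓ₂]` some cut `R ∈ (0, d₀]`, threshold `β₂` and reference values `n_β(w)` satisfy: for `β ≥ β₂`, every cube
`(c,b)` with `b·a(β) ≤ ℓ₂`, every exterior `η`, every site `z` with `R/a(β) + 2 ≤ depth z` and `d₀ ≤ a(β)·depth z`, every finite `B`
containing the lattice ball `{w : a(β)‖w‖ < R}` and every radial profile `|φ| ≤ 1` vanishing on `[R, ∞)`:
`|Σ_{w∈B} φ(a(β)‖w‖)(kerCov_η(dens(z+w), dens z) − n_β(w))| ≤ κ/depth(c,b,z)⁴`. -/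
def SymNearCovLaw : Prop :=
  ∃ ℓ₂ : ℝ, 0 < ℓ₂ ∧ ∀ κ : ℝ, 0 < κ → ∀ d₀ : ℝ, 0 < d₀ → d₀ ≤ ℓ₂ → ∃ R : ℝ, 0 < R ∧ R ≤ d₀ ∧
    ∃ (β₂ : ℝ) (n : ℝ → (Fin 4 → ℤ) → ℝ),
      ∀ β : ℝ, β₂ ≤ β → ∀ (c : Fin 4 → ℤ) (b : ℕ), (b : ℝ) * a β ≤ ℓ₂ →
        ∀ (η : LGConfig 4 G) (z : Fin 4 → ℤ) (B : Finset (Fin 4 → ℤ)),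
          (∀ w : Fin 4 → ℤ, a β * ‖siteToE w‖ < R → w ∈ B) →
          R / a β + 2 ≤ (depth c b z : ℝ) → d₀ ≤ a β * (depth c b z : ℝ) →
          ∀ φ : ℝ → ℝ, (∀ t, |φ t| ≤ 1) → (∀ t, R ≤ t → φ t = 0) →
            |∑ w ∈ B, φ (a β * ‖siteToE w‖) *
                (kerCov G r β c b η (dens G r (z + w)) (dens G r z) - n β w)| ≤ κ / (depth c b z : ℝ) ^ 4

end SignedFemto

/-- **Statement of `stub_symNearCovLaw` of line «signed-femto-collar»** (ASYMPTOTIC-FREEDOM class, femto currency, the line's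
debt): `SymNearCovLaw G r a` along a unit pinned by a compactly supported positive-time clause-(i) floor witness. -/
def SymNearCovLawSigR : Prop :=
  ∀ (G : Type) [Group G] [TopologicalSpace G] [IsTopologicalGroup G] [CompactSpace G],
    IsCompactSimpleLieGroup G →
    letI : MeasurableSpace G := borel G
    haveI : BorelSpace G := ⟨rfl⟩
    ∀ (r : LatticeRep G) (a : ℝ → ℝ), (∀ β, 0 < a β) → Filter.Tendsto a Filter.atTop (nhds 0) →
      (∃ (v₀ : SchwartzMap (EuclideanSpace ℝ (Fin 4)) ℝ) (ε β₅ Λ₅ : ℝ), HasCompactSupport v₀ ∧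
        tsupport v₀ ⊆ {y : EuclideanSpace ℝ (Fin 4) | 0 < y 0} ∧ 0 < ε ∧
        ∀ β : ℝ, β₅ ≤ β → ∀ L : ℕ, Λ₅ ≤ a β * L → ε ≤ Q2 G r β L (a β) (thetaTest 4 v₀) v₀) →
      SymNearCovLaw G r a

/-- **Statement of the torus-level signed radial collar kernel** (design frs-p2, verbatim; conclusion of `stub_symContactOfFemto`,
hypothesis of `stub_signedOfSymKernel`): along a pinned unit, for pairs `(y,z)` at physical torus separation in `[r₁,r₂]` and every
`κ > 0` a cut `R > 0` such that for all large `β`, tori `a(β)·L ≥ Λ₀`, every `z` whose physical `R`-ball lies inside the box and every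
radial profile `|φ| ≤ 1` vanishing on `[R,∞)`: `|Σ_{x ∈ box L} φ(a(β)‖x − z‖) κ₃^T(x,y,z)| ≤ κ·a(β)⁸`. -/
def SymContactKernelSigR : Prop :=
  ∀ (G : Type) [Group G] [TopologicalSpace G] [IsTopologicalGroup G] [CompactSpace G],
    IsCompactSimpleLieGroup G →
    letI : MeasurableSpace G := borel G
    haveI : BorelSpace G := ⟨rfl⟩
    ∀ (r : LatticeRep G) (a : ℝ → ℝ), (∀ β, 0 < a β) → Filter.Tendsto a Filter.atTop (nhds 0) →
      (∃ (v₀ : SchwartzMap (EuclideanSpace ℝ (Fin 4)) ℝ) (ε β₅ Λ₅ : ℝ), HasCompactSupport v₀ ∧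
        tsupport v₀ ⊆ {y : EuclideanSpace ℝ (Fin 4) | 0 < y 0} ∧ 0 < ε ∧
        ∀ β : ℝ, β₅ ≤ β → ∀ L : ℕ, Λ₅ ≤ a β * L → ε ≤ Q2 G r β L (a β) (thetaTest 4 v₀) v₀) →
      ∀ r₁ r₂ : ℝ, 0 < r₁ → r₁ ≤ r₂ → ∀ κ : ℝ, 0 < κ →
        ∃ R : ℝ, 0 < R ∧ ∃ β₀ Λ₀ : ℝ, ∀ β : ℝ, β₀ ≤ β → ∀ L : ℕ, Λ₀ ≤ a β * L →
          ∀ y ∈ box 4 L, ∀ z ∈ box 4 L,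
            r₁ ≤ a β * Summit.QuantumFields.YangMills.Cruxes.RunningCouplingCeiling.Pointwise.torusDist L y z →
            a β * Summit.QuantumFields.YangMills.Cruxes.RunningCouplingCeiling.Pointwise.torusDist L y z ≤ r₂ →
            (∀ w : Fin 4 → ℤ, a β * ‖siteToE w‖ < R → z + w ∈ box 4 L) →
            ∀ φ : ℝ → ℝ, (∀ t, |φ t| ≤ 1) → (∀ t, R ≤ t → φ t = 0) →
              |∑ x ∈ box 4 L, φ (a β * ‖siteToE (x - z)‖) * torusK3 G r β L x y z| ≤ κ * (a β) ^ 8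

/-- **Statement of `stub_symContactOfFemto` of line «signed-femto-collar»** (ANALYSIS, provable now; width seat frs-p2): the femto
laws along the pinned unit imply the torus-level signed radial collar kernel (the collar transfer of `contactKernel_of_femto` with the
radial weight inside the near observable). -/
def SymContactOfFemtoSigR : Prop :=
  FBLPinnedSigR → SymNearCovLawSigR → SymContactKernelSigR

/-- **Statement of `stub_signedOfSymKernel` of line «signed-femto-collar»** (ANALYSIS, provable now; width seat frs-p2): the signed
radial collar kernel and the frozen-boundary law (for the offset shell, via `MomentBounds`) imply the RESTATED (rev-6) crux
`ResponseLocalisation` — its body verbatim: the signed smooth-collar share with a `[0,1]`-valued Schwartz cut-off. -/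
def SignedOfSymKernelSigR : Prop :=
  SymContactKernelSigR → FBLPinnedSigR →
  ∀ (G : Type) [Group G] [TopologicalSpace G] [IsTopologicalGroup G] [CompactSpace G], IsCompactSimpleLieGroup G → letI : MeasurableSpace G := borel G; haveI : BorelSpace G := ⟨rfl⟩; ∀ (r : LatticeRep G) (a : ℝ → ℝ), (∀ β, 0 < a β) → Filter.Tendsto a Filter.atTop (nhds 0) → ∀ (p : EuclideanSpace ℝ (Fin 4)), 0 < p 0 → ∀ (ε : ℝ), 0 < ε → ∀ η : ℝ, 0 < η → ∀ Λ : ℝ, 1 ≤ Λ → ∃ ρ : ℝ, 0 < ρ ∧ ∀ v : SchwartzMap (EuclideanSpace ℝ (Fin 4)) ℝ, tsupport v ⊆ Metric.closedBall p ρ → tsupport v ⊆ {y : EuclideanSpace ℝ (Fin 4) | 0 < y 0} → (∫ y, |v y|) ≤ 1 → (∃ β₅ Λ₅ : ℝ, ∀ β : ℝ, β₅ ≤ β → ∀ L : ℕ, Λ₅ ≤ a β * L → ε ≤ Q2 G r β L (a β) (thetaTest 4 v) v) → ∃ δ : ℝ, 0 < δ ∧ ∃ χ : SchwartzMap (EuclideanSpace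 ℝ (Fin 4)) ℝ, (∀ y ∈ Metric.thickening δ (tsupport v ∪ tsupport (thetaTest 4 v)), χ y = 1) ∧ (∀ y : EuclideanSpace ℝ (Fin 4), χ y ∈ Set.Icc (0 : ℝ) 1) ∧ (∃ R₁ : ℝ, ∀ y : EuclideanSpace ℝ (Fin 4), R₁ < ‖y‖ → χ y = 0) ∧ ∃ β₆ Λ₆ : ℝ, ∀ β : ℝ, β₆ ≤ β → ∀ L : ℕ, Λ₆ ≤ a β * L → ∀ l : ℝ, l ∈ Set.Icc 1 Λ → |∑ x ∈ box 4 L, χ ((l * a β) • siteToE x) * ∑ y ∈ box 4 L, ∑ z ∈ box 4 L, (thetaTest 4 v) ((l * a β) • siteToE y) * v ((l * a β) • siteToE z) * torusK3 G r β L x y z| ≤ η * (1 + |deriv (fun c : ℝ => Q2 G r c L (l * a β) (thetaTest 4 v) v) β|)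


/-! ## Line «signed-femto-collar», ENGINE FORM of the AF debt (lead ym-line-frs-p1 g5, 2026-08-28): the CENTRE of
CENTRED cubes only, REFERENCE-FREE (two exteriors compared)

`SymNearCovLaw` asks for reference values `n_β(w)` on EVERY femto cube at EVERY deep site.  By the law of total
covariance through the centred sub-cube of radius `depth − 1` (DLR consistency, `kerE_kerE_of_subset`) and the
frozen-boundary law `FBL` (the line's other stub, `fbl_of_fbl6 ∘ stub_fbl6Pinned`) — the covariance of the sub-cube
kernel MEANS is second order in the boundary law and is absorbed by shrinking the cut `R` after `κ, d₀` — the following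
ONE-PARAMETER statement suffices (`CentredOsc.symNearCovLaw_of_centredOsc`,
`Theorems/ForcedResponseSkewnessResponseLocalisationSymNearCovOfCentredOsc.lean`, toolkit
`…CentredOscToolkit.lean`), and it is what a multi-scale expansion in a cube with prescribed exterior compares:

* `CentredOscLaw G r a` — `∃ ℓ₂ ∀ κ ∀ d₀ ∈ (0,ℓ₂] ∃ R ∈ (0,d₀] ∃ β₂ ∀ β ≥ β₂ ∀ N` (`(2N+1)·a β ≤ ℓ₂`, `R/a β + 2 ≤ N+1`,
  `d₀ ≤ a β·(N+1)`) `∀ η η' ∀ finite B ⊇ {w : a β‖w‖ < R} ∀ radial |φ| ≤ 1 vanishing on [R,∞)`: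
  `|Σ_{w∈B} φ(a β‖w‖)·(kerCov_η^{[-N,N]⁴}(dens w, dens 0) − kerCov_{η'}^{[-N,N]⁴}(dens w, dens 0))| ≤ κ/(N+1)⁴`;
* `CentredOscLawSigR` — the same along a unit pinned by a compactly supported positive-time clause-(i) floor witness
  (the AF stub `stub_centredOsc` of skeleton v3 of line «signed-femto-collar»; `SymNearCovLawSigR` is then DERIVED:
  `symNearCovLawSigR_of_centredOsc (fblPinnedSigR_of_fbl6 stub_fbl6Pinned) stub_centredOsc`).
Equivalent to `SymNearCovLaw` modulo `FBL` up to constants (the converse direction is the triangle inequality through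
`n_β`; centred cubes are cubes).  Same one-loop model audit as `SymNearCovLaw` (frs-p3 07:55Z): d-wave background term
cancels on lattice spheres, isotropic running remainder `≍ ḡ²(R)`, contact `≍ g₀²(β)`, `∇²𝔅`/image terms `(R/d₀)²`,
`(R/d₀)⁴`.  Engine: Bałaban small-field RG in ONE femto cube with two arbitrary exteriors — not in print (Bałaban 1989,
CMP 122, p. 356; Magnen–Rivasseau–Sénéor 1993, CMP 155, pp. 325–326).  Nothing here is asserted. -/

section CentredOsc

variable (G : Type) [Group G] [TopologicalSpace G] [IsTopologicalGroup G] [CompactSpace G]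
  [MeasurableSpace G] [BorelSpace G] (r : LatticeRep G) (a : ℝ → ℝ)

/-- **Centred reference-free oscillation law** (femto, two exteriors; ENGINE FORM of the AF clause of line
«signed-femto-collar»): a femto scale `ℓ₂ > 0` such that for every `κ > 0` and physical depth `d₀ ∈ (0, ℓ₂]` some cut
`R ∈ (0, d₀]` and threshold `β₂` satisfy: for `β ≥ β₂`, every radius `N` with `(2N+1)·a(β) ≤ ℓ₂`, `R/a(β) + 2 ≤ N+1`
and `d₀ ≤ a(β)·(N+1)`, every two exteriors `η, η'` of the centred cube `[-N, N]⁴`, every finite `B` containing the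
lattice ball `{w : a(β)‖w‖ < R}` and every radial profile `|φ| ≤ 1` vanishing on `[R, ∞)`, the signed radial sums
`Σ_{w∈B} φ(a(β)‖w‖)·kerCov^{[-N,N]⁴}(dens w, dens 0)` under `η` and under `η'` differ by at most `κ/(N+1)⁴`. -/
def CentredOscLaw : Prop :=
  ∃ ℓ₂ : ℝ, 0 < ℓ₂ ∧ ∀ κ : ℝ, 0 < κ → ∀ d₀ : ℝ, 0 < d₀ → d₀ ≤ ℓ₂ →
    ∃ R : ℝ, 0 < R ∧ R ≤ d₀ ∧ ∃ β₂ : ℝ, ∀ β : ℝ, β₂ ≤ β → ∀ N : ℕ, ((2 * N + 1 : ℕ) : ℝ) * a β ≤ ℓ₂ →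
      R / a β + 2 ≤ (N : ℝ) + 1 → d₀ ≤ a β * ((N : ℝ) + 1) →
      ∀ (η η' : LGConfig 4 G) (B : Finset (Fin 4 → ℤ)),
        (∀ w : Fin 4 → ℤ, a β * ‖siteToE w‖ < R → w ∈ B) →
        ∀ φ : ℝ → ℝ, (∀ t, |φ t| ≤ 1) → (∀ t, R ≤ t → φ t = 0) →
          |∑ w ∈ B, φ (a β * ‖siteToE w‖) *
              (kerCov G r β (fun _ => -(N : ℤ)) (2 * N + 1) η (dens G r w) (dens G r 0) -
                kerCov G r β (fun _ => -(N : ℤ)) (2 * N + 1) η' (dens G r w) (dens G r 0))| ≤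
            κ / ((N : ℝ) + 1) ^ 4

end CentredOsc

/-- **Statement of `stub_centredOsc` of line «signed-femto-collar» (skeleton v3)** (ASYMPTOTIC-FREEDOM class, femto
currency, engine form of the line's debt): the centred reference-free oscillation law `CentredOscLaw G r a` along a
unit pinned by a compactly supported positive-time clause-(i) floor witness. -/
def CentredOscLawSigR : Prop :=
  ∀ (G : Type) [Group G] [TopologicalSpace G] [IsTopologicalGroup G] [CompactSpace G],
    IsCompactSimpleLieGroup G →
    letI : MeasurableSpace G := borel G
    haveI : BorelSpace G := ⟨rfl⟩
    ∀ (r : LatticeRep G) (a : ℝ → ℝ), (∀ β, 0 < a β) → Filter.Tendsto a Filter.atTop (nhds 0) →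
      (∃ (v₀ : SchwartzMap (EuclideanSpace ℝ (Fin 4)) ℝ) (ε β₅ Λ₅ : ℝ), HasCompactSupport v₀ ∧
        tsupport v₀ ⊆ {y : EuclideanSpace ℝ (Fin 4) | 0 < y 0} ∧ 0 < ε ∧
        ∀ β : ℝ, β₅ ≤ β → ∀ L : ℕ, Λ₅ ≤ a β * L → ε ≤ Q2 G r β L (a β) (thetaTest 4 v₀) v₀) →
      CentredOscLaw G r a

end Summit.QuantumFields.YangMills.Cruxes.ResponseLocalisation.Birth

end
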